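import Summits.QuantumFields.YangMills.Theorems.LuscherReductionTwistedTraceScalingCurvatureStep
import Summits.QuantumFields.YangMills.Theorems.LuscherReductionTwistedTraceScalingStepHypotheses
import Summits.QuantumFields.YangMills.Theorems.LuscherReductionTwistedTraceScalingStepForm
import Summits.QuantumFields.YangMills.Theorems.LuscherReductionTwistedTraceScalingGnomonicKineticLattice
import HarnessLib

/-!
# The transfer kernel along a near step, in the gnomonic chart: TWO-SIDED GAUSSIAN MODEL with explicit errors
# (covariant programme, brick c4(iii)-step II)

Cell `ym-fleet`, crux `TwistedTraceScaling` (stmt-QuantumFields-20203), line «twolattice», stub S-BASE, lane B = COARSE-LOWER(L₁)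
(design note `pub/ym-fleet/ym-20203-coarse-s1/LOWER-BLUEPRINT.md` §5–§6, c4(iii)).  HONEST FRAMING: fixed-lattice bookkeeping of one transfer
step around an ARBITRARY small-action configuration; a stub of a child of the CONDITIONAL reduction route (femto rung R2b1); not a gap, not Clay.

For a configuration `U` with `S(U) ≤ σ ≤ 1/16` and a step `W = P(y)` of the vacuum pattern of the gnomonic chart with `|y_e|² ≤ ρ²`, `ρ ≤ 1/100`, on
every link, the transfer kernel `K_β(U, W·U) = E_β(1, W) · e^{−(β/2)(S(U) + S(W·U))}` (`Cov.transferKernel_mul_left_eq`) is the Gaussian model of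
the covariant programme up to EXPLICIT errors:

* `vecPart_chart_bounds` — the step links lie in the upper hemisphere with `|vecPart(W_e)_c| ≤ ρ`;
* `abs_covCurl_apply_le` — `|(D_U w)_{p,c}| ≤ 10ρ` for `|w| ≤ ρ`; `norm_le_sqrt_card_mul` — componentwise ⇒ Euclidean bounds;
* ★ `wilsonAction_step_ge` / `wilsonAction_step_le` — with `G := F(U) + D_U(linkVec W) ∈ PlaqSpace` (curvature plus covariant curl of the step,
  bricks c1 `Cov.abs_plaqCurv_mul_sub_covCurl_le` and c3 `Cov.norm_plaqCurv_sq_le_wilsonAction` / `Cov.wilsonAction_le_of_scalarPart_nonneg`):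
  `‖G‖² − η₁ ≤ S(W·U) ≤ ‖G‖² + η₂`, `η₁ = stepErrLo ρ σ N`, `η₂ = stepErrUp ρ σ N`, `N = 3|P|`, explicit polynomials with
  `η₁, η₂ = O(N^{3/2}(ρ³ + ρ²√σ + ρσ) + N²ρ⁴ + σ²)` — at `ρ ≍ β^{−1/2}`, `σ ≍ β^{−1}` (up to logarithms) `βηᵢ = O(β^{−1/2}) ≪ β^{−1/3}`;
  `scalarPart_hol_step_nonneg` — the plaquettes of `W·U` stay in the upper hemisphere (needed for the upper action bound);
* ★★ `transferKernel_step_chart_sandwich` —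
  `e^{2β|E|} e^{−β Σ|y_e|²} e^{−(β/2)(S(U) + ‖G‖² + η₂)} ≤ K_β(U, W·U) ≤ e^{2β|E|} e^{−β(1+ρ²)⁻² Σ|y_e|²} e^{−(β/2)(S(U) + ‖G‖² − η₁)}`
  (kinetic factor: `GnChart.latE_gnomonic_sandwich`).
Combined with `…StepNearFar` (near/far split, chart measure) this is the true step against which the harmonic model of `…HarmonicStepMode` /
`…HarmonicStepFrame` / `…SpectralWeight` is integrated.

## References
* M. Lüscher, Nucl. Phys. B219 (1983) 233, §3 (expansion of the transfer matrix around a background). [Luscher1983]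
* E. Seiler, LNP 159 (1982), §3. [SeilerLNP1982]
-/

noncomputable section

open Real
open Literature.MathematicalPhysics.QuantumFieldTheory
open Literature.MathematicalPhysics.QuantumLattice
open Literature.MathematicalPhysics.QuantumFieldTheory.Balaban1983to89.T4CubeChartGnomonic (gnoPoint gnoPoint_zero)

namespace Summit.QuantumFields.YangMills.Theorems.FemtoTransferGap.TwoLattice.Cov

open Summit.QuantumFields.YangMills.Theorems.FemtoTransferGap
open Summit.QuantumFields.YangMills.Theorems.FemtoTransferGap.TwoLattice
open Summit.QuantumFields.YangMills.Theorems.FemtoTransferGap.TwoLattice.Stiff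
open Summit.QuantumFields.YangMills.Theorems.FemtoTransferGap.TwoLattice.GnChart

variable {L : ℕ} [NeZero L]

/-! ## §1 The step links in the chart -/

omit [NeZero L] in
/-- From `Σ_a y_a² ≤ ρ²` (`ρ ≥ 0`): `|y_c| ≤ ρ` for every component. [folklore] -/
theorem abs_le_of_sum_sq_le {y : Fin 3 → ℝ} {ρ : ℝ} (hρ : 0 ≤ ρ) (hy : ∑ a, y a ^ 2 ≤ ρ ^ 2) (c : Fin 3) : |y c| ≤ ρ := by
  have h1 : y c ^ 2 ≤ ∑ a, y a ^ 2 := Finset.single_le_sum (f := fun a => y a ^ 2) (fun a _ => sq_nonneg _) (Finset.mem_univ c)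
  exact abs_le_of_sq_le_sq' (h1.trans hy) hρ |>.elim (fun h h' => abs_le.mpr ⟨h, h'⟩)

omit [NeZero L] in
/-- ★ A chart link `P(1, y_e)` with `Σ_a y_e,a² ≤ ρ²`: upper hemisphere, and `|vecPart_c| ≤ ρ` (indeed `vecPart = s·y`, `0 < s ≤ 1`). [folklore] -/
theorem vecPart_chart_bounds {ρ : ℝ} (hρ : 0 ≤ ρ) {y : Fin 3 → ℝ} (hy : ∑ a, y a ^ 2 ≤ ρ ^ 2) :
    0 ≤ scalarPart (gnoPoint y) ∧ ∀ c, |vecPart (gnoPoint y) c| ≤ ρ := by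
  obtain ⟨hs, hsq, hv⟩ := gnoPoint_chart y
  have hA : 0 ≤ ∑ a, y a ^ 2 := Finset.sum_nonneg fun a _ => sq_nonneg _
  have hs1 : scalarPart (gnoPoint y) ≤ 1 := by nlinarith
  refine ⟨hs.le, fun c => ?_⟩
  rw [hv c, abs_mul, abs_of_pos hs]
  calc scalarPart (gnoPoint y) * |y c| ≤ 1 * |y c| := mul_le_mul_of_nonneg_right hs1 (abs_nonneg _)
    _ ≤ ρ := by rw [one_mul]; exact abs_le_of_sum_sq_le hρ hy c

omit [NeZero L] in
/-- The step configuration of the chart: hemisphere and component bounds on every link. [folklore] -/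
theorem chart_step_bounds {ρ : ℝ} (hρ : 0 ≤ ρ) {y : Edge 3 L → Fin 3 → ℝ} (hy : ∀ e, ∑ a, y e a ^ 2 ≤ ρ ^ 2) :
    (∀ e, 0 ≤ scalarPart (latPatternChart L (fun _ => false) y e)) ∧
      ∀ (e : Edge 3 L) (c : Fin 3), |vecPart (latPatternChart L (fun _ => false) y e) c| ≤ ρ := by
  refine ⟨fun e => ?_, fun e c => ?_⟩
  · rw [latPatternChart_false]; exact (vecPart_chart_bounds hρ (hy e)).1
  · rw [latPatternChart_false]; exact (vecPart_chart_bounds hρ (hy e)).2 c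

/-! ## §2 Componentwise bounds: the covariant curl of a small step, Euclidean packaging -/

omit [NeZero L] in
/-- `|Σ_b Ad(P)_{a b} w_b| ≤ 3ρ` for `|w_b| ≤ ρ` (`|Ad_{ab}| ≤ 1`). [folklore] -/
theorem abs_sum_adRot_mul_le (P : SU2) (a : Fin 3) {w : Fin 3 → ℝ} {ρ : ℝ} (hw : ∀ b, |w b| ≤ ρ) :
    |∑ b, adRot P a b * w b| ≤ 3 * ρ := by
  have h : ∀ b, |adRot P a b * w b| ≤ ρ := fun b => by
    rw [abs_mul]
    calc |adRot P a b| * |w b| ≤ 1 * |w b| := mul_le_mul_of_nonneg_right (abs_adRot_le_one P a b) (abs_nonneg _)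
      _ ≤ ρ := by rw [one_mul]; exact hw b
  calc |∑ b, adRot P a b * w b| ≤ ∑ b, |adRot P a b * w b| := Finset.abs_sum_le_sum_abs _ _
    _ ≤ ∑ _b : Fin 3, ρ := Finset.sum_le_sum fun b _ => h b
    _ = 3 * ρ := by simp

omit [NeZero L] in
/-- ★ The covariant curl of a small step is small: `|w_{e,b}| ≤ ρ` on every link ⇒ `|(D_U w)_{p,c}| ≤ 10ρ`. [cite: Luscher1983, §3] -/
theorem abs_covCurl_apply_le (U : GaugeConfig 3 L SU2) {w : LinkSpace L} {ρ : ℝ} (hw : ∀ (e : Edge 3 L) (b : Fin 3), |w (e, b)| ≤ ρ)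
    (q : Plaquette 3 L × Fin 3) : |covCurl U w q| ≤ 10 * ρ := by
  obtain ⟨⟨x, ij⟩, a⟩ := q
  rw [covCurl_apply]
  have h1 := hw (x, ij.1.1) a
  have h2 := abs_sum_adRot_mul_le (ptrans1 U (x, ij)) a (w := fun b => w ((x.shift ij.1.1, ij.1.2), b)) fun b => hw _ b
  have h3 := abs_sum_adRot_mul_le (ptrans2 U (x, ij)) a (w := fun b => w ((x.shift ij.1.2, ij.1.1), b)) fun b => hw _ b
  have h4 := abs_sum_adRot_mul_le (hol U (x, ij)) a (w := fun b => w ((x, ij.1.2), b)) fun b => hw _ b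
  have hρ : 0 ≤ ρ := (abs_nonneg _).trans h1
  calc |w ((x, ij.1.1), a) + ∑ b, adRot (ptrans1 U (x, ij)) a b * w ((x.shift ij.1.1, ij.1.2), b)
        - ∑ b, adRot (ptrans2 U (x, ij)) a b * w ((x.shift ij.1.2, ij.1.1), b)
        - ∑ b, adRot (hol U (x, ij)) a b * w ((x, ij.1.2), b)|
      ≤ |w ((x, ij.1.1), a)| + |∑ b, adRot (ptrans1 U (x, ij)) a b * w ((x.shift ij.1.1, ij.1.2), b)|
        + |∑ b, adRot (ptrans2 U (x, ij)) a b * w ((x.shift ij.1.2, ij.1.1), b)|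
        + |∑ b, adRot (hol U (x, ij)) a b * w ((x, ij.1.2), b)| := by
          refine (abs_sub _ _).trans (add_le_add ((abs_sub _ _).trans (add_le_add (abs_add_le _ _) le_rfl)) le_rfl)
    _ ≤ ρ + 3 * ρ + 3 * ρ + 3 * ρ := by linarith
    _ = 10 * ρ := by ring

/-- Euclidean packaging of a componentwise bound on `PlaqSpace`: `|X_i| ≤ c` (`c ≥ 0`) ⇒ `‖X‖ ≤ c·√N`, `N = |P|·3`. [folklore] -/
theorem norm_le_sqrt_card_mul {X : PlaqSpace L} {c : ℝ} (hc : 0 ≤ c) (h : ∀ i, |X i| ≤ c) :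
    ‖X‖ ≤ c * Real.sqrt (Fintype.card (Plaquette 3 L × Fin 3)) := by
  have hsq : ‖X‖ ^ 2 ≤ (c * Real.sqrt (Fintype.card (Plaquette 3 L × Fin 3))) ^ 2 := by
    rw [EuclideanSpace.norm_sq_eq, mul_pow, Real.sq_sqrt (Nat.cast_nonneg _)]
    calc ∑ i, ‖X i‖ ^ 2 ≤ ∑ _i : Plaquette 3 L × Fin 3, c ^ 2 := Finset.sum_le_sum fun i _ => by
            rw [Real.norm_eq_abs, sq_abs]; exact sq_le_sq' (abs_le.mp (h i)).1 (abs_le.mp (h i)).2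
      _ = c ^ 2 * Fintype.card (Plaquette 3 L × Fin 3) := by simp [mul_comm]
  exact (pow_le_pow_iff_left₀ (norm_nonneg X) (by positivity) two_ne_zero).mp hsq

/-- ★ `‖D_U w‖ ≤ 10ρ·√N` for a step with `|w_{e,b}| ≤ ρ`. [cite: Luscher1983, §3] -/
theorem norm_covCurl_le (U : GaugeConfig 3 L SU2) {w : LinkSpace L} {ρ : ℝ} (hρ : 0 ≤ ρ) (hw : ∀ (e : Edge 3 L) (b : Fin 3), |w (e, b)| ≤ ρ) :
    ‖covCurl U w‖ ≤ 10 * ρ * Real.sqrt (Fintype.card (Plaquette 3 L × Fin 3)) :=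
  norm_le_sqrt_card_mul (by positivity) (abs_covCurl_apply_le U hw)

/-- `‖F(U)‖ ≤ √σ` on `{S ≤ σ}`. [cite: Luscher1983, §3] -/
theorem norm_plaqCurv_le_sqrt (U : GaugeConfig 3 L SU2) {σ : ℝ} (hS : wilsonAction su2Rep U ≤ σ) : ‖plaqCurv U‖ ≤ Real.sqrt σ := by
  rw [← Real.sqrt_sq (norm_nonneg (plaqCurv U))]
  exact Real.sqrt_le_sqrt ((norm_plaqCurv_sq_le_wilsonAction U).trans hS)

/-! ## §3 The error budgets -/

/-- The per-component remainder of brick c1 on the chart ball, for `σ ≤ 1/16`: `r(ρ,σ) = 720ρ² + 66ρ√σ`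
(`≥ 288ρ² + 1728ρ²√σ + 72ρσ + 48ρ√σ` when `√σ ≤ 1/4`). [cite: Luscher1983, §3] -/
def stepRem (ρ σ : ℝ) : ℝ := 720 * ρ ^ 2 + 66 * ρ * Real.sqrt σ

/-- The LOWER error of the action after a step: `η₁ = 2(√σ + 10ρ√N)·√N·r`. [cite: Luscher1983, §3] -/
def stepErrLo (ρ σ N : ℝ) : ℝ := 2 * (Real.sqrt σ + 10 * ρ * Real.sqrt N) * (Real.sqrt N * stepRem ρ σ)

/-- The UPPER error of the action after a step: `η₂ = η₁ + N r² + (√σ + 10ρ√N + √N r)⁴`. [cite: Luscher1983, §3] -/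
def stepErrUp (ρ σ N : ℝ) : ℝ :=
  stepErrLo ρ σ N + (Real.sqrt N * stepRem ρ σ) ^ 2 + (Real.sqrt σ + 10 * ρ * Real.sqrt N + Real.sqrt N * stepRem ρ σ) ^ 4

omit [NeZero L] in
/-- The c1 remainder is dominated by `stepRem` when `√σ ≤ 1/4`, `ρ ≥ 0`. [folklore] -/
theorem c1_rem_le_stepRem {ρ σ : ℝ} (hρ : 0 ≤ ρ) (hσ : σ ≤ 1 / 16) :
    288 * ρ ^ 2 + 1728 * ρ ^ 2 * Real.sqrt σ + 72 * ρ * Real.sqrt σ ^ 2 + 48 * ρ * Real.sqrt σ ≤ stepRem ρ σ := by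
  have hs : Real.sqrt σ ≤ 1 / 4 := by
    rw [show (1 : ℝ) / 4 = Real.sqrt (1 / 16) by rw [show (1:ℝ)/16 = (1/4)^2 by norm_num, Real.sqrt_sq (by norm_num)]]
    exact Real.sqrt_le_sqrt hσ
  have hs0 : 0 ≤ Real.sqrt σ := Real.sqrt_nonneg σ
  unfold stepRem
  nlinarith [mul_nonneg hρ hs0, mul_nonneg (sq_nonneg ρ) hs0, mul_nonneg (mul_nonneg hρ hs0) hs0]

/-! ## §4 The action after a near step, two-sided in `G = F(U) + D_U(linkVec W)` -/

section Step

variable {ρ σ : ℝ} (U : GaugeConfig 3 L SU2) (y : Edge 3 L → Fin 3 → ℝ)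

omit [NeZero L] in
/-- Components of the model curvature after the step. [folklore] -/
private theorem G_apply (w : LinkSpace L) (q : Plaquette 3 L × Fin 3) :
    (plaqCurv U + covCurl U w) q = plaqCurv U q + covCurl U w q := rfl

/-- ★ **Componentwise c1 on the chart ball**: with `W = P(y)`, `|y_e|² ≤ ρ²`, `ρ ≤ 1/30`, `S(U) ≤ σ < 2`:
`|F(W·U)_{p,c} − (F(U) + D_U linkVec W)_{p,c}| ≤ 288ρ² + 1728ρ²√σ + 72ρσ + 48ρ√σ`. [cite: Luscher1983, §3] -/
theorem abs_plaqCurv_step_sub_le (hρ0 : 0 ≤ ρ) (hρ : ρ ≤ 1 / 30) (hσ : σ < 2) (hS : wilsonAction su2Rep U ≤ σ)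
    (hy : ∀ e, ∑ a, y e a ^ 2 ≤ ρ ^ 2) (q : Plaquette 3 L × Fin 3) :
    |plaqCurv (latPatternChart L (fun _ => false) y * U) q -
        (plaqCurv U + covCurl U (linkVec L (latPatternChart L (fun _ => false) y))) q| ≤
      288 * ρ ^ 2 + 1728 * ρ ^ 2 * Real.sqrt σ + 72 * ρ * Real.sqrt σ ^ 2 + 48 * ρ * Real.sqrt σ := by
  obtain ⟨p, c⟩ := q
  obtain ⟨hs, hv⟩ := chart_step_bounds (L := L) hρ0 hy
  obtain ⟨hH, hF⟩ := hol_hypotheses_of_wilsonAction_le U hσ hS p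
  rw [G_apply, plaqCurv_apply, plaqCurv_apply]
  have h := abs_plaqCurv_mul_sub_covCurl_le (latPatternChart L (fun _ => false) y) U p hρ hs hv hH hF c
  simp only [plaqCurv_apply] at h
  convert h using 2
  ring

/-- ★ **Euclidean c1**: `‖F(W·U) − G‖ ≤ √N · stepRem ρ σ` (`σ ≤ 1/16`, `ρ ≤ 1/30`). [cite: Luscher1983, §3] -/
theorem norm_plaqCurv_step_sub_le (hρ0 : 0 ≤ ρ) (hρ : ρ ≤ 1 / 30) (hσ : σ ≤ 1 / 16) (hS : wilsonAction su2Rep U ≤ σ)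
    (hy : ∀ e, ∑ a, y e a ^ 2 ≤ ρ ^ 2) :
    ‖plaqCurv (latPatternChart L (fun _ => false) y * U) -
        (plaqCurv U + covCurl U (linkVec L (latPatternChart L (fun _ => false) y)))‖ ≤
      Real.sqrt (Fintype.card (Plaquette 3 L × Fin 3)) * stepRem ρ σ := by
  rw [mul_comm]
  refine norm_le_sqrt_card_mul ((by positivity : (0:ℝ) ≤ 288 * ρ ^ 2 + 1728 * ρ ^ 2 * Real.sqrt σ +
    72 * ρ * Real.sqrt σ ^ 2 + 48 * ρ * Real.sqrt σ).trans (c1_rem_le_stepRem hρ0 hσ)) fun q => ?_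
  rw [PiLp.sub_apply]
  exact (abs_plaqCurv_step_sub_le U y hρ0 hρ (by linarith) hS hy q).trans (c1_rem_le_stepRem hρ0 hσ)

/-- `‖G‖ ≤ √σ + 10ρ√N`. [cite: Luscher1983, §3] -/
theorem norm_G_le (hρ0 : 0 ≤ ρ) (hS : wilsonAction su2Rep U ≤ σ) (hy : ∀ e, ∑ a, y e a ^ 2 ≤ ρ ^ 2) :
    ‖plaqCurv U + covCurl U (linkVec L (latPatternChart L (fun _ => false) y))‖ ≤
      Real.sqrt σ + 10 * ρ * Real.sqrt (Fintype.card (Plaquette 3 L × Fin 3)) := by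
  refine (norm_add_le _ _).trans (add_le_add (norm_plaqCurv_le_sqrt U hS) (norm_covCurl_le U hρ0 fun e b => ?_))
  rw [linkVec_apply]
  exact (chart_step_bounds (L := L) hρ0 hy).2 e b

/-- ★ **LOWER ACTION BOUND after a near step**: `‖G‖² − η₁ ≤ S(W·U)`, `η₁ = stepErrLo ρ σ N`. [cite: Luscher1983, §3] -/
theorem wilsonAction_step_ge (hρ0 : 0 ≤ ρ) (hρ : ρ ≤ 1 / 30) (hσ : σ ≤ 1 / 16) (hS : wilsonAction su2Rep U ≤ σ)
    (hy : ∀ e, ∑ a, y e a ^ 2 ≤ ρ ^ 2) :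
    ‖plaqCurv U + covCurl U (linkVec L (latPatternChart L (fun _ => false) y))‖ ^ 2 -
        stepErrLo ρ σ (Fintype.card (Plaquette 3 L × Fin 3)) ≤
      wilsonAction su2Rep (latPatternChart L (fun _ => false) y * U) := by
  set W := latPatternChart L (fun _ => false) y
  set G := plaqCurv U + covCurl U (linkVec L W)
  set F' := plaqCurv (W * U)
  set d := Real.sqrt (Fintype.card (Plaquette 3 L × Fin 3)) * stepRem ρ σ with hd
  have hdist : ‖F' - G‖ ≤ d := norm_plaqCurv_step_sub_le U y hρ0 hρ hσ hS hy
  have hG : ‖G‖ ≤ Real.sqrt σ + 10 * ρ * Real.sqrt (Fintype.card (Plaquette 3 L × Fin 3)) := norm_G_le U y hρ0 hS hy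
  have hS' : ‖F'‖ ^ 2 ≤ wilsonAction su2Rep (W * U) := norm_plaqCurv_sq_le_wilsonAction (W * U)
  have htri : ‖G‖ - ‖F' - G‖ ≤ ‖F'‖ := by
    have := norm_sub_norm_le G F'
    rw [norm_sub_rev] at this
    linarith
  have hd0 : 0 ≤ ‖F' - G‖ := norm_nonneg _
  -- `‖G‖² − 2‖G‖·‖F'−G‖ ≤ ‖F'‖²`
  have hkey : ‖G‖ ^ 2 - 2 * ‖G‖ * ‖F' - G‖ ≤ ‖F'‖ ^ 2 := by
    by_cases hc : ‖F' - G‖ ≤ ‖G‖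
    · nlinarith [norm_nonneg F', norm_nonneg G]
    · push Not at hc
      nlinarith [norm_nonneg F', norm_nonneg G]
  have hη : 2 * ‖G‖ * ‖F' - G‖ ≤ stepErrLo ρ σ (Fintype.card (Plaquette 3 L × Fin 3)) := by
    unfold stepErrLo
    rw [← hd]
    exact mul_le_mul (mul_le_mul_of_nonneg_left hG (by norm_num)) hdist hd0 (by positivity)
  linarith

/-- The plaquettes of `W·U` stay in the upper hemisphere (`ρ ≤ 1/100`, `σ ≤ 1/16`). [cite: Luscher1983, §3] -/
theorem scalarPart_hol_step_nonneg (hρ0 : 0 ≤ ρ) (hρ : ρ ≤ 1 / 100) (hσ : σ ≤ 1 / 16) (hS : wilsonAction su2Rep U ≤ σ)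
    (hy : ∀ e, ∑ a, y e a ^ 2 ≤ ρ ^ 2) (p : Plaquette 3 L) :
    0 ≤ scalarPart (hol (latPatternChart L (fun _ => false) y * U) p) := by
  set W := latPatternChart L (fun _ => false) y
  obtain ⟨hs, hv⟩ := chart_step_bounds (L := L) hρ0 hy
  obtain ⟨hH, hF⟩ := hol_hypotheses_of_wilsonAction_le U (by linarith : σ < 2) hS p
  -- the four factors of the transported step
  set A₁ := W (p.1, p.2.1.1) with hA₁
  set A₂ := ptrans1 U p * W (p.1.shift p.2.1.1, p.2.1.2) * (ptrans1 U p)⁻¹ with hA₂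
  set A₃ := (ptrans2 U p * W (p.1.shift p.2.1.2, p.2.1.1) * (ptrans2 U p)⁻¹)⁻¹ with hA₃
  set A₄ := (hol U p * W (p.1, p.2.1.2) * (hol U p)⁻¹)⁻¹ with hA₄
  have hX : transportStep W U p = A₁ * (A₂ * (A₃ * A₄)) := by
    simp only [transportStep, hA₁, hA₂, hA₃, hA₄, mul_assoc]
  have h1s : 0 ≤ scalarPart A₁ := hs _
  have h1v : ∀ b, |vecPart A₁ b| ≤ 3 * ρ := fun b => (hv _ b).trans (by linarith)
  obtain ⟨h2s, h2v⟩ := conj_factor_bounds (ptrans1 U p) (W (p.1.shift p.2.1.1, p.2.1.2)) (hs _) (hv _)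
  obtain ⟨h3s, h3v⟩ := conj_inv_factor_bounds (ptrans2 U p) (W (p.1.shift p.2.1.2, p.2.1.1)) (hs _) (hv _)
  obtain ⟨h4s, h4v⟩ := conj_inv_factor_bounds (hol U p) (W (p.1, p.2.1.2)) (hs _) (hv _)
  have ht : 3 * ρ ≤ 1 / 10 := by linarith
  obtain ⟨-, bX, sX, -⟩ := abs_vecPart_prod4_sub_sum_le h1s h2s h3s h4s ht h1v h2v h3v h4v
  rw [hol_mul_eq_transportStep_mul, hX]
  have hsσ : Real.sqrt σ ≤ 1 / 4 := by
    rw [show (1 : ℝ) / 4 = Real.sqrt (1 / 16) by rw [show (1:ℝ)/16 = (1/4)^2 by norm_num, Real.sqrt_sq (by norm_num)]]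
    exact Real.sqrt_le_sqrt hσ
  refine scalarPart_mul_nonneg sX hH bX hF ?_
  nlinarith [Real.sqrt_nonneg σ, mul_nonneg hρ0 (Real.sqrt_nonneg σ)]

/-- `Σ_p (Σ_a F_{p,a}²)² ≤ ‖F‖⁴`. [folklore] -/
theorem sum_sq_sq_le_norm_pow_four (V : GaugeConfig 3 L SU2) :
    ∑ p : Plaquette 3 L, (∑ a, vecPart (hol V p) a ^ 2) ^ 2 ≤ (‖plaqCurv V‖ ^ 2) ^ 2 := by
  rw [norm_plaqCurv_sq, sq (∑ p : Plaquette 3 L, _), Finset.sum_mul_sum]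
  refine Finset.sum_le_sum fun p _ => ?_
  rw [sq]
  exact Finset.single_le_sum (f := fun q => (∑ a, vecPart (hol V p) a ^ 2) * ∑ a, vecPart (hol V q) a ^ 2)
    (fun q _ => mul_nonneg (Finset.sum_nonneg fun a _ => sq_nonneg _) (Finset.sum_nonneg fun a _ => sq_nonneg _)) (Finset.mem_univ p)

/-- ★ **UPPER ACTION BOUND after a near step**: `S(W·U) ≤ ‖G‖² + η₂`, `η₂ = stepErrUp ρ σ N` (`ρ ≤ 1/100`, `σ ≤ 1/16`). [cite: Luscher1983, §3] -/
theorem wilsonAction_step_le (hρ0 : 0 ≤ ρ) (hρ : ρ ≤ 1 / 100) (hσ : σ ≤ 1 / 16) (hS : wilsonAction su2Rep U ≤ σ)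
    (hy : ∀ e, ∑ a, y e a ^ 2 ≤ ρ ^ 2) :
    wilsonAction su2Rep (latPatternChart L (fun _ => false) y * U) ≤
      ‖plaqCurv U + covCurl U (linkVec L (latPatternChart L (fun _ => false) y))‖ ^ 2 +
        stepErrUp ρ σ (Fintype.card (Plaquette 3 L × Fin 3)) := by
  set W := latPatternChart L (fun _ => false) y
  set G := plaqCurv U + covCurl U (linkVec L W)
  set F' := plaqCurv (W * U)
  set N : ℝ := (Fintype.card (Plaquette 3 L × Fin 3) : ℝ)
  set d := Real.sqrt N * stepRem ρ σ with hd
  have hdist : ‖F' - G‖ ≤ d := norm_plaqCurv_step_sub_le U y hρ0 (by linarith) hσ hS hy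
  have hG : ‖G‖ ≤ Real.sqrt σ + 10 * ρ * Real.sqrt N := norm_G_le U y hρ0 hS hy
  have hhemi : ∀ p : Plaquette 3 L, 0 ≤ scalarPart (hol (W * U) p) := scalarPart_hol_step_nonneg U y hρ0 hρ hσ hS hy
  have hS' : wilsonAction su2Rep (W * U) ≤ ‖F'‖ ^ 2 + (‖F'‖ ^ 2) ^ 2 :=
    (wilsonAction_le_of_scalarPart_nonneg (W * U) hhemi).trans (add_le_add le_rfl (sum_sq_sq_le_norm_pow_four (W * U)))
  have htri : ‖F'‖ ≤ ‖G‖ + ‖F' - G‖ := by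
    have := norm_add_le G (F' - G); rwa [add_sub_cancel] at this
  have hd0 : 0 ≤ ‖F' - G‖ := norm_nonneg _
  have hF'le : ‖F'‖ ≤ Real.sqrt σ + 10 * ρ * Real.sqrt N + d := by linarith
  have hF'0 : 0 ≤ ‖F'‖ := norm_nonneg _
  have h4 : (‖F'‖ ^ 2) ^ 2 ≤ (Real.sqrt σ + 10 * ρ * Real.sqrt N + d) ^ 4 := by
    rw [← pow_mul]; exact pow_le_pow_left₀ hF'0 hF'le 4
  have h2 : ‖F'‖ ^ 2 ≤ ‖G‖ ^ 2 + 2 * ‖G‖ * ‖F' - G‖ + ‖F' - G‖ ^ 2 := by nlinarith [norm_nonneg G]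
  have hη : 2 * ‖G‖ * ‖F' - G‖ ≤ stepErrLo ρ σ N := by
    unfold stepErrLo; rw [← hd]
    exact mul_le_mul (mul_le_mul_of_nonneg_left hG (by norm_num)) hdist hd0 (by positivity)
  have hdd : ‖F' - G‖ ^ 2 ≤ d ^ 2 := pow_le_pow_left₀ hd0 hdist 2
  unfold stepErrUp
  rw [← hd]
  linarith

/-! ## §5 The kernel -/

/-- ★★ **THE TRANSFER KERNEL ALONG A NEAR STEP IS THE GAUSSIAN MODEL UP TO EXPLICIT ERRORS.**  For `β ≥ 0`, `0 ≤ ρ ≤ 1/100`, `0 ≤ σ ≤ 1/16`,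
`S(U) ≤ σ` and `|y_e|² ≤ ρ²` on every link, with `W = P(y)`, `G = F(U) + D_U(linkVec W)`, `N = 3|P|`:
`e^{2β|E|} e^{−βΣ|y|²} e^{−(β/2)(S(U)+‖G‖²+η₂)} ≤ K_β(U, W·U) ≤ e^{2β|E|} e^{−β(1+ρ²)⁻²Σ|y|²} e^{−(β/2)(S(U)+‖G‖²−η₁)}`.
[cite: Luscher1983, §3] [cite: SeilerLNP1982, §3] -/
theorem transferKernel_step_chart_sandwich {β : ℝ} (hβ : 0 ≤ β) (hρ0 : 0 ≤ ρ) (hρ : ρ ≤ 1 / 100) (hσ : σ ≤ 1 / 16)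
    (hS : wilsonAction su2Rep U ≤ σ) (hy : ∀ e, ∑ a, y e a ^ 2 ≤ ρ ^ 2) :
    Real.exp (2 * β) ^ Fintype.card (Edge 3 L) * Real.exp (-(β * ∑ e : Edge 3 L, ∑ a, y e a ^ 2)) *
        Real.exp (-(β / 2) * (wilsonAction su2Rep U +
          (‖plaqCurv U + covCurl U (linkVec L (latPatternChart L (fun _ => false) y))‖ ^ 2 +
            stepErrUp ρ σ (Fintype.card (Plaquette 3 L × Fin 3))))) ≤
      transferKernel su2Rep β U (latPatternChart L (fun _ => false) y * U) ∧
    transferKernel su2Rep β U (latPatternChart L (fun _ => false) y * U) ≤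
      Real.exp (2 * β) ^ Fintype.card (Edge 3 L) * Real.exp (-(β / (1 + ρ ^ 2) ^ 2 * ∑ e : Edge 3 L, ∑ a, y e a ^ 2)) *
        Real.exp (-(β / 2) * (wilsonAction su2Rep U +
          (‖plaqCurv U + covCurl U (linkVec L (latPatternChart L (fun _ => false) y))‖ ^ 2 -
            stepErrLo ρ σ (Fintype.card (Plaquette 3 L × Fin 3))))) := by
  set W := latPatternChart L (fun _ => false) y with hW
  have h0 : latPatternChart L (fun _ => false) (0 : Edge 3 L → Fin 3 → ℝ) = 1 := by
    funext e; rw [latPatternChart_false]; exact gnoPoint_zero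
  -- kinetic factor
  have hkin := latE_gnomonic_sandwich L hβ (ρ := ρ) 0 y (fun e => by simp; positivity) hy
  rw [h0] at hkin
  simp only [Pi.zero_apply, zero_sub, even_two, Even.neg_pow] at hkin
  obtain ⟨hk1, hk2⟩ := hkin
  -- magnetic factors
  have hlo := wilsonAction_step_ge U y hρ0 (by linarith) hσ hS hy
  have hup := wilsonAction_step_le U y hρ0 hρ hσ hS hy
  rw [transferKernel_mul_left_eq]
  have hβ2 : 0 ≤ β / 2 := by linarith
  constructor
  · refine mul_le_mul hk1 (Real.exp_le_exp.mpr ?_) (Real.exp_pos _).le (latE_pos β _ _).le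
    nlinarith
  · refine mul_le_mul hk2 (Real.exp_le_exp.mpr ?_) (Real.exp_pos _).le (by positivity)
    nlinarith

end Step

end Summit.QuantumFields.YangMills.Theorems.FemtoTransferGap.TwoLattice.Cov

end
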